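import Literature.Analysis.FluidPDE.PlanarChainCutoffs
import HarnessLib

/-!
# Checks for chains: rational boxes, disjointness by computation, affine thresholds, clocks

Topic `Literature/Analysis/FluidPDE`. Helper file of the explicit pullback calculus for the planar
transport equation. A design instantiates a chain (`PlanarChainCutoffs.ChainData`) with RATIONAL
data; this file provides the three generic devices by which its finitely many side conditions are
discharged:

* **rational boxes** `QBox` with `QBox.toPlateau : QBox → BoxPlateau`, a Boolean separation test
  `QBox.sep` and its list version `QBox.allSep`, and the soundness lemmas
  (`QBox.not_mem_supp_of_sep`, `QBox.disjoint_of_allSep`): the disjointness field of a chain's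
  well-formedness follows from `allSep boxes = true`, i.e. from `decide`;
* **affine thresholds**: every moving quantity of a phase is affine in one clock value
  `a ∈ [0,1]`; an inequality between two such quantities holds for all `a ∈ [0,1]` as soon as it
  holds at `a = 0` and `a = 1` (`affine_le_affine_of_endpoints`, strict and mixed versions);
* **clocks** `clock t₀ τ t = step ((t - t₀)/τ)`: smooth, valued in `[0,1]`, `0` before
  `t₀ + τ/3`, `1` after `t₀ + 2τ/3`, with derivative `clockDeriv` vanishing outside the
  transition (`hasDerivAt_clock`, …) — the flat reparametrisation of a phase on its time slot.

Folklore; no named facts. Infrastructure towards a discharge of `acm_compatible_blocks`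
(`QuasiSelfSimilarCompatibleBlocks.lean`).

## References

* G. Alberti, G. Crippa, A. L. Mazzucato, *Exponential self-similar mixing by incompressible
  flows*, J. Amer. Math. Soc. 32 (2019), 445–490, §§7–8 (arXiv:1605.02090).
-/

noncomputable section

open Function Set Filter
open scoped Topology ContDiff

namespace Literature.Analysis.FluidPDE

namespace PlanarKinematics

open Gluing

/-- The plane `ℝ²` as a Euclidean space. [folklore] -/
local notation "E²" => EuclideanSpace ℝ (Fin 2)

/-! ## Rational boxes -/

/-- **Rational box plateau data**: outer box `[a₀,b₀] × [a₁,b₁]` and transition length `ρ`, all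
rational. [folklore] -/
structure QBox where
  /-- left end, axis `0` -/
  a₀ : ℚ
  /-- right end, axis `0` -/
  b₀ : ℚ
  /-- lower end, axis `1` -/
  a₁ : ℚ
  /-- upper end, axis `1` -/
  b₁ : ℚ
  /-- transition length -/
  ρ : ℚ
  deriving DecidableEq, Inhabited

namespace QBox

/-- The real box plateau of a rational box. [folklore] -/
def toPlateau (q : QBox) : BoxPlateau := ⟨q.a₀, q.b₀, q.a₁, q.b₁, q.ρ⟩

/-- The fields of the real box plateau. [folklore] -/
@[simp] theorem toPlateau_a₀ (q : QBox) : q.toPlateau.a₀ = q.a₀ := rfl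
/-- The fields of the real box plateau. [folklore] -/
@[simp] theorem toPlateau_b₀ (q : QBox) : q.toPlateau.b₀ = q.b₀ := rfl
/-- The fields of the real box plateau. [folklore] -/
@[simp] theorem toPlateau_a₁ (q : QBox) : q.toPlateau.a₁ = q.a₁ := rfl
/-- The fields of the real box plateau. [folklore] -/
@[simp] theorem toPlateau_b₁ (q : QBox) : q.toPlateau.b₁ = q.b₁ := rfl
/-- The fields of the real box plateau. [folklore] -/
@[simp] theorem toPlateau_ρ (q : QBox) : q.toPlateau.ρ = q.ρ := rfl

/-- Positivity of the transition length transfers. [folklore] -/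
theorem toPlateau_ρ_pos {q : QBox} (h : 0 < q.ρ) : 0 < q.toPlateau.ρ := by
  rw [toPlateau_ρ]; exact_mod_cast h

/-- **Separation test** of two rational boxes: their support boxes
`[a₀ + ρ/3, b₀ - ρ/3] × [a₁ + ρ/3, b₁ - ρ/3]` are separated along one of the axes. [folklore] -/
def sep (p q : QBox) : Bool :=
  decide (p.b₀ - p.ρ / 3 < q.a₀ + q.ρ / 3) || decide (q.b₀ - q.ρ / 3 < p.a₀ + p.ρ / 3) ||
    decide (p.b₁ - p.ρ / 3 < q.a₁ + q.ρ / 3) || decide (q.b₁ - q.ρ / 3 < p.a₁ + p.ρ / 3)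

/-- **Soundness of the separation test**: separated rational boxes have disjoint real support
boxes. [folklore] -/
theorem not_mem_supp_of_sep {p q : QBox} (h : sep p q = true) (z : E²) (hz : z ∈ p.toPlateau.supp) :
    z ∉ q.toPlateau.supp := by
  intro hz'
  obtain ⟨h1, h2, h3, h4⟩ := hz
  obtain ⟨h1', h2', h3', h4'⟩ := hz'
  simp only [toPlateau_a₀, toPlateau_b₀, toPlateau_a₁, toPlateau_b₁, toPlateau_ρ] at h1 h2 h3 h4 h1' h2' h3' h4'
  simp only [sep, Bool.or_eq_true, decide_eq_true_eq] at h
  rcases h with ((hs | hs) | hs) | hs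
  · have hs' : ((p.b₀ - p.ρ / 3 : ℚ) : ℝ) < ((q.a₀ + q.ρ / 3 : ℚ) : ℝ) := by exact_mod_cast hs
    push_cast at hs'
    linarith
  · have hs' : ((q.b₀ - q.ρ / 3 : ℚ) : ℝ) < ((p.a₀ + p.ρ / 3 : ℚ) : ℝ) := by exact_mod_cast hs
    push_cast at hs'
    linarith
  · have hs' : ((p.b₁ - p.ρ / 3 : ℚ) : ℝ) < ((q.a₁ + q.ρ / 3 : ℚ) : ℝ) := by exact_mod_cast hs
    push_cast at hs'
    linarith
  · have hs' : ((q.b₁ - q.ρ / 3 : ℚ) : ℝ) < ((p.a₁ + p.ρ / 3 : ℚ) : ℝ) := by exact_mod_cast hs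
    push_cast at hs'
    linarith

/-- The box plateaus of a list of rational boxes (default beyond the list). [folklore] -/
def plateaus (L : List QBox) (k : ℕ) : BoxPlateau := (L.getD k default).toPlateau

/-- **All-pairs separation test**: every two boxes of the list whose indices differ by at least
`2` are separated. [folklore] -/
def allSep (L : List QBox) : Bool :=
  (List.range L.length).all fun i => (List.range L.length).all fun j =>
    !decide (i + 2 ≤ j) || sep (L.getD i default) (L.getD j default)

/-- **Soundness of the all-pairs test**: the disjointness condition of a chain whose boxes are
`plateaus L`. [folklore] -/
theorem disjoint_of_allSep {L : List QBox} (h : allSep L = true) :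
    ∀ j < L.length, ∀ k < L.length, j + 2 ≤ k → ∀ z : E², z ∈ (plateaus L j).supp → z ∉ (plateaus L k).supp := by
  intro j hj k hk hjk z hz
  simp only [allSep, List.all_eq_true, List.mem_range, Bool.or_eq_true, Bool.not_eq_true',
    decide_eq_false_iff_not] at h
  rcases h j hj k hk with hnot | hsep
  · exact absurd hjk hnot
  · exact not_mem_supp_of_sep hsep z hz

/-- Positivity of all transition lengths from a Boolean test. [folklore] -/
def allPos (L : List QBox) : Bool := L.all fun q => decide (0 < q.ρ)

/-- **Soundness of the positivity test.** [folklore] -/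
theorem ρ_pos_of_allPos {L : List QBox} (h : allPos L = true) : ∀ k < L.length, 0 < (plateaus L k).ρ := by
  intro k hk
  simp only [allPos, List.all_eq_true, decide_eq_true_eq] at h
  have hmem : L.getD k default ∈ L := by
    rw [List.getD_eq_getElem?_getD, List.getElem?_eq_getElem hk, Option.getD_some]
    exact List.getElem_mem hk
  exact toPlateau_ρ_pos (h _ hmem)

end QBox

/-! ## Affine thresholds -/

/-- **Affine inequalities from the endpoints**: if `f₀ ≤ g₀` and `f₁ ≤ g₁` then the affine
interpolants satisfy `f₀ + (f₁ - f₀) a ≤ g₀ + (g₁ - g₀) a` for every `a ∈ [0,1]`. [folklore] -/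
theorem affine_le_affine_of_endpoints {f₀ f₁ g₀ g₁ a : ℝ} (h0 : f₀ ≤ g₀) (h1 : f₁ ≤ g₁) (ha : a ∈ Icc (0 : ℝ) 1) :
    f₀ + (f₁ - f₀) * a ≤ g₀ + (g₁ - g₀) * a := by
  obtain ⟨ha0, ha1⟩ := ha
  nlinarith

/-- **Strict affine inequalities from the endpoints.** [folklore] -/
theorem affine_lt_affine_of_endpoints {f₀ f₁ g₀ g₁ a : ℝ} (h0 : f₀ < g₀) (h1 : f₁ < g₁) (ha : a ∈ Icc (0 : ℝ) 1) :
    f₀ + (f₁ - f₀) * a < g₀ + (g₁ - g₀) * a := by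
  obtain ⟨ha0, ha1⟩ := ha
  have h4 : 0 < (g₀ - f₀) * (1 - a) + (g₁ - f₁) * a := by
    rcases lt_or_eq_of_le ha1 with hlt | heq
    · have h5 : 0 < (g₀ - f₀) * (1 - a) := mul_pos (sub_pos.2 h0) (sub_pos.2 hlt)
      have h6 : 0 ≤ (g₁ - f₁) * a := mul_nonneg (sub_pos.2 h1).le ha0
      linarith
    · subst heq
      have h5 : 0 < g₁ - f₁ := sub_pos.2 h1
      linarith
  linarith

/-- **An affine quantity stays in the interval spanned by its endpoints** (lower bound). [folklore] -/
theorem min_le_affine {f₀ f₁ a : ℝ} (ha : a ∈ Icc (0 : ℝ) 1) : min f₀ f₁ ≤ f₀ + (f₁ - f₀) * a := by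
  obtain ⟨ha0, ha1⟩ := ha
  rcases le_total f₀ f₁ with h | h
  · rw [min_eq_left h]; nlinarith
  · rw [min_eq_right h]; nlinarith

/-- **An affine quantity stays in the interval spanned by its endpoints** (upper bound). [folklore] -/
theorem affine_le_max {f₀ f₁ a : ℝ} (ha : a ∈ Icc (0 : ℝ) 1) : f₀ + (f₁ - f₀) * a ≤ max f₀ f₁ := by
  obtain ⟨ha0, ha1⟩ := ha
  rcases le_total f₀ f₁ with h | h
  · rw [max_eq_right h]; nlinarith
  · rw [max_eq_left h]; nlinarith

/-! ## Clocks -/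

/-- **The clock of a time slot**: `clock t₀ τ t = step ((t - t₀)/τ)`, the flat smooth
reparametrisation of `[t₀, t₀ + τ]` onto `[0, 1]`. [folklore] -/
def clock (t₀ τ : ℝ) (t : ℝ) : ℝ := step ((t - t₀) / τ)

/-- **The derivative of the clock** in closed form. [folklore] -/
def clockDeriv (t₀ τ : ℝ) (t : ℝ) : ℝ := deriv step ((t - t₀) / τ) / τ

/-- Unfolding the clock. [folklore] -/
theorem clock_apply (t₀ τ t : ℝ) : clock t₀ τ t = step ((t - t₀) / τ) := rfl

/-- The clock is smooth. [folklore] -/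
theorem clock_contDiff (t₀ τ : ℝ) {n : ℕ∞} : ContDiff ℝ n (clock t₀ τ) :=
  step_contDiff.comp ((contDiff_id.sub contDiff_const).div_const _)

/-- The clock takes values in `[0,1]`. [folklore] -/
theorem clock_mem_Icc (t₀ τ t : ℝ) : clock t₀ τ t ∈ Icc (0 : ℝ) 1 := step_mem_Icc _

/-- **The clock is `0` before the transition.** [folklore] -/
theorem clock_of_le {t₀ τ t : ℝ} (hτ : 0 < τ) (ht : t ≤ t₀ + τ / 3) : clock t₀ τ t = 0 := by
  apply step_of_le
  rw [div_le_iff₀ hτ]; linarith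

/-- **The clock is `1` after the transition.** [folklore] -/
theorem clock_of_ge {t₀ τ t : ℝ} (hτ : 0 < τ) (ht : t₀ + 2 * τ / 3 ≤ t) : clock t₀ τ t = 1 := by
  apply step_of_ge
  rw [le_div_iff₀ hτ]; linarith

/-- The clock vanishes at the start of the slot. [folklore] -/
theorem clock_start {t₀ τ : ℝ} (hτ : 0 < τ) : clock t₀ τ t₀ = 0 := clock_of_le hτ (by linarith)

/-- The clock is `1` at the end of the slot. [folklore] -/
theorem clock_end {t₀ τ : ℝ} (hτ : 0 < τ) : clock t₀ τ (t₀ + τ) = 1 := clock_of_ge hτ (by linarith)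

/-- **The derivative of the clock.** [folklore] -/
theorem hasDerivAt_clock (t₀ : ℝ) {τ : ℝ} (hτ : τ ≠ 0) (t : ℝ) : HasDerivAt (clock t₀ τ) (clockDeriv t₀ τ t) t := by
  have h1 : HasDerivAt (fun s => (s - t₀) / τ) (1 / τ) t := by
    simpa using ((hasDerivAt_id t).sub_const t₀).div_const τ
  have h2 : HasDerivAt step (deriv step ((t - t₀) / τ)) ((t - t₀) / τ) :=
    (step_contDiff (n := 1)).differentiable one_ne_zero _ |>.hasDerivAt
  have h := h2.comp t h1
  refine (h.congr_deriv ?_).congr_of_eventuallyEq (Eventually.of_forall fun s => rfl)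
  simp only [clockDeriv]; field_simp

/-- The derivative of the clock, as `deriv`. [folklore] -/
theorem deriv_clock (t₀ : ℝ) {τ : ℝ} (hτ : τ ≠ 0) : deriv (clock t₀ τ) = clockDeriv t₀ τ :=
  funext fun t => (hasDerivAt_clock t₀ hτ t).deriv

/-- The derivative of the clock is smooth. [folklore] -/
theorem clockDeriv_contDiff (t₀ : ℝ) {τ : ℝ} (hτ : τ ≠ 0) {n : ℕ∞} : ContDiff ℝ n (clockDeriv t₀ τ) := by
  rw [← deriv_clock t₀ hτ]
  have h := clock_contDiff t₀ τ (n := n + 1)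
  exact h.deriv'

/-- **The clock is flat before the transition.** [folklore] -/
theorem clockDeriv_of_lt {t₀ τ t : ℝ} (hτ : 0 < τ) (ht : t < t₀ + τ / 3) : clockDeriv t₀ τ t = 0 := by
  rw [clockDeriv, deriv_step_of_lt, zero_div]
  rw [div_lt_iff₀ hτ]; linarith

/-- **The clock is flat after the transition.** [folklore] -/
theorem clockDeriv_of_gt {t₀ τ t : ℝ} (hτ : 0 < τ) (ht : t₀ + 2 * τ / 3 < t) : clockDeriv t₀ τ t = 0 := by
  rw [clockDeriv, deriv_step_of_gt, zero_div]
  rw [lt_div_iff₀ hτ]; linarith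

/-- **Affine motions driven by a clock**: `x(t) = x₀ + (x₁ - x₀) clock(t)` has derivative
`(x₁ - x₀) clockDeriv(t)`. [folklore] -/
theorem hasDerivAt_affine_clock (x₀ x₁ t₀ : ℝ) {τ : ℝ} (hτ : τ ≠ 0) (t : ℝ) :
    HasDerivAt (fun s => x₀ + (x₁ - x₀) * clock t₀ τ s) ((x₁ - x₀) * clockDeriv t₀ τ t) t := by
  simpa using ((hasDerivAt_clock t₀ hτ t).const_mul (x₁ - x₀)).const_add x₀

/-- An affine motion driven by a clock is smooth. [folklore] -/
theorem contDiff_affine_clock (x₀ x₁ t₀ τ : ℝ) {n : ℕ∞} : ContDiff ℝ n fun s => x₀ + (x₁ - x₀) * clock t₀ τ s :=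
  contDiff_const.add (contDiff_const.mul (clock_contDiff t₀ τ))

/-- An affine motion driven by a clock stays between its endpoints. [folklore] -/
theorem affine_clock_mem_Icc (x₀ x₁ t₀ τ t : ℝ) :
    x₀ + (x₁ - x₀) * clock t₀ τ t ∈ Icc (min x₀ x₁) (max x₀ x₁) :=
  ⟨min_le_affine (clock_mem_Icc t₀ τ t), affine_le_max (clock_mem_Icc t₀ τ t)⟩

end PlanarKinematics

end Literature.Analysis.FluidPDE
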